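import Summits.BirchSwinnertonDyer.BirchSwinnertonDyer.Theorems.ByReductionTypeAtTwoTowerLambdaRankAdditive
import Summits.BirchSwinnertonDyer.BirchSwinnertonDyer.Theorems.ByReductionTypeAtTwoSelmerCoinvariantsEraseOne
import Summits.BirchSwinnertonDyer.BirchSwinnertonDyer.Theorems.ByReductionTypeAtTwoTorsionEulerCharH46
import HarnessLib

/-!
# The `λ`-ROAD WITH RATIONAL `2`-TORSION at analytic rank `0`, WITHOUT the print binders `h415` (Greenberg Prop. 4.15 (i))
# and `hEC` (Greenberg Thm. 4.1@2): the additive TOWER doors re-derived from kernel theorems — a NEW leaf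

Cell `bsd-2adic` (run/shared/lean/pub/bsd-2adic/), seat `bsd-2adic-tower-1` GEN 40; `--supports stmt-BirchSwinnertonDyer-19271`
(helper, item `OrdKatoHalfAtTwo`, TOWER / λ-road). THEOREMS ONLY (no definition, no named fact, no instance, no `sorry`); closes no
item; nothing booked; NO existing door or row file is re-keyed (RC-500 (a) / D-0152: new leaf only); BSD is not proved by any of this.

The doors of `Theorems/ByReductionTypeAtTwoTowerLambdaRankAdditive.lean` (seat bsd-2adic-ord-3 GEN 6; consumed by the INELIG λ-road
row modules `…TowerLambdaRankAdditiveRows*`) display `h415 : Greenberg1999.prop415i_noFiniteSubmodule_of_additive` (and, at rank `0`,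
`hEC : X5.O1.TwoAdicEulerCharRankZero W 0`). On their habitat — `GoodOrd W 2`, `analyticRank = 0` (or `Sel_{2^∞}(E/ℚ)` finite), an
additive odd prime — BOTH are now kernel theorems: `h415` by `SelmerCoinvEraseOne.forall_finite_eq_bot_two_of_additive_rankZero`
(GEN 40: Greenberg's Prop. 4.15 (i) proof on the rank-`0` locus = Cassels descent for `(Sel_∞)_γ` with Cassels ERASE-ONE at the additive
place), `hEC` by `TorsionEulerChar.H46.twoAdicEulerCharRankZero` (GEN 39). This leaf re-derives the doors without them:

* `le_lambda_of_towerGap_of_towerRank_of_additive_finiteSelmer` / `…_rankZero` — `n ≤ λ(X)` from `TowerGapAtTwo W` + the RANK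
  certificate, `GoodOrd W 2`, an additive `v ∤ 2`, and `Sel_{2^∞}(E/ℚ)` finite (resp. GZK + `analyticRank = 0`); ANY rational `2`-torsion.
* `mazurMainConjecture/katoHalfAt/eisensteinAt_two_of_towerGap_of_towerRank_of_additive_rankZero` (+ `_finiteSelmer`) — PRINT
  {Kato 17.4 (1)(2)@2} (+ GZK) + `hper₀` + certificates.
* **`bsdp_two_of_towerGap_of_towerRank_of_additive_rankZero`** — `BSDp W 2` from PRINT {modularity `hmod`, GZK `hGZK`, Kato 17.4 (1)(2)@2
  `h17`} + per-row data {`GoodOrd W 2`, `r_an = 0`, an additive `v ∤ 2`, `hper₀`} + certificates {`TowerGapAtTwo W`, RANK, `λ_an = n`,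
  `μ_an = 0`} — the trust base of the `E[2]`-irreducible TOWER rows, now also for the even-torsion additive λ-road rows;
  `missingLowerBoundAt_two_of_towerGap_of_towerRank_of_additive_rankZero` (item 19577 shape).

MIGRATION (by name, for a row file touched anyway): `bsdp_two_of_towerGap_of_towerRank_of_additive W hmod hGZK h17 hEC h415 hadd hper₀ hgo hr
hgap hrank hlan hμan` ↦ `bsdp_two_of_towerGap_of_towerRank_of_additive_rankZero W hmod hGZK h17 hadd hper₀ hgo hr hgap hrank hlan hμan`.

References: [GreenbergLNM1716] Thm. 4.1 (p. 102), §4 p. 104, Prop. 4.15 (i) (pp. 124–125); [Kato2004Asterisque] Thm. 17.4 (1)(2)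
(p. 273); [Miller2011LMS] Def. 1.1; [Washington1997] §13.2.
-/

set_option autoImplicit false
-- the Theorems namespace of this sub repeats the summit name by design (D-0017 nested layout)
set_option linter.dupNamespace false

noncomputable section

open scoped Classical MatrixGroups ModularForm

open NumberField IsDedekindDomain CongruenceSubgroup WeierstrassCurve Literature.NumberTheory.EllipticCurves
  Literature.NumberTheory.EllipticCurves.ModularForms Literature.NumberTheory.EllipticCurves.Rank1Residual
  Literature.NumberTheory.EllipticCurves.Rank1Residual.Typed
  Literature.NumberTheory.EllipticCurves.Greenberg1999
  Summit.BirchSwinnertonDyer.Rank1Residual.X1.MuLambda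
  Summit.BirchSwinnertonDyer.Rank1Residual.X1.MuPart
  Summit.BirchSwinnertonDyer.Rank1Residual.X1.ParitySqueeze
  Summit.BirchSwinnertonDyer.BirchSwinnertonDyer.Theorems.Rank1ResidualX1Defs
  Summit.BirchSwinnertonDyer.Rank1Residual.X5 Summit.BirchSwinnertonDyer.Rank1Residual.X5.O1
  Summit.BirchSwinnertonDyer.Rank1Residual.X5.TowerGap Summit.BirchSwinnertonDyer.Rank1Residual
  Summit.BirchSwinnertonDyer.BirchSwinnertonDyer.Theorems
  Summit.BirchSwinnertonDyer.BirchSwinnertonDyer.Theorems.KatoHalfPinch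

namespace Summit.BirchSwinnertonDyer.BirchSwinnertonDyer.Theorems.TowerLambdaTorsion

variable (W : WeierstrassCurve ℚ) [W.IsElliptic] [W.IsGloballyMinimal]

/-! ## §1 `n ≤ λ(X)` with the KERNEL Prop. 4.15 (i) on the rank-`0` locus — no torsion hypothesis, no `h415` -/

/-- **`n ≤ λ(X(E/ℚ_∞))` from finite-layer data, ANY `E(ℚ)_tors`, NO print binder — `Sel`-finite form.** `GoodOrd W 2`,
`Sel_{2^∞}(E/ℚ)` finite, an additive place `v ∤ 2` (KERNEL Prop. 4.15 (i): `SelmerCoinvEraseOne.forall_finite_eq_bot_two_of_additive_finiteSelmer`)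
+ certificates `TowerGapAtTwo W` (⟺ `X` torsion ∧ `μ(X) = 0`) and RANK `∃ j, 2^n ≤ #X/(2,T^j)X` ⇒ `n ≤ λ(X)`.
[cite: GreenbergLNM1716, Prop. 4.15 (i) (pp. 124–125)] [cite: Washington1997, §13.2] -/
theorem le_lambda_of_towerGap_of_towerRank_of_additive_finiteSelmer (hgo : GoodOrd W 2) [Finite (W.selmerGroupPInfty 2)]
    (hadd : ∃ v : HeightOneSpectrum (𝓞 ℚ), ((2 : ℕ) : 𝓞 ℚ) ∉ v.asIdeal ∧ W.HasAdditiveReductionAt v)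
    (hgap : TowerGapAtTwo W) {n : ℕ}
    (hrank : ∀ (κ : ZpExtension ℚ 2) (γ : Field.absoluteGaloisGroup ℚ), κ.IsCyclotomic →
      κ.IsTopGenerator γ → IsCyclotomicVariable 2 γ → ∀ D : W.SelmerDualData κ γ,
      ∃ j : ℕ, 2 ^ n ≤ Nat.card (D.X ⧸ (towerIdeal 2 j • ⊤ : Submodule (IwasawaAlgebra 2) D.X)))
    (κ : ZpExtension ℚ 2) (γ : Field.absoluteGaloisGroup ℚ) (hκ : κ.IsCyclotomic)
    (hγ : κ.IsTopGenerator γ) (hγ' : IsCyclotomicVariable 2 γ) (D : W.SelmerDualData κ γ) :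
    n ≤ D.lambda := by
  haveI : Module.Finite (IwasawaAlgebra 2) D.X := D.module_finite_holds hγ
  obtain ⟨hX, hμ⟩ := isTorsion_and_mu_eq_zero_of_towerGapAtTwo W hgap hκ hγ hγ' D
  obtain ⟨j, hj⟩ := hrank κ γ hκ hγ hγ' D
  exact le_lambdaInvariant_of_pow_le_natCard_quotient_towerIdeal 2 hX hμ
    (fun N hN => SelmerCoinvEraseOne.forall_finite_eq_bot_two_of_additive_finiteSelmer W hgo hadd κ γ hκ hγ D N hN) hj

/-- **`n ≤ λ(X(E/ℚ_∞))` from finite-layer data at analytic rank `0`, ANY `E(ℚ)_tors`.** PRINT = GZK only (`Sel_{2^∞}(E/ℚ)` finite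
from `analyticRank = 0`); `GoodOrd W 2`, an additive `v ∤ 2`, `TowerGapAtTwo W`, RANK certificate ⇒ `n ≤ λ(X)` — the door
`le_lambda_of_towerGap_of_towerRank_of_additive` WITHOUT `h415`. [cite: GreenbergLNM1716, Prop. 4.15 (i) (pp. 124–125)]
[cite: Darmon2004, Thm. 3.22] -/
theorem le_lambda_of_towerGap_of_towerRank_of_additive_rankZero (hGZK : rank_eq_analyticRank_of_analyticRank_le_one)
    (hgo : GoodOrd W 2) (hr : W.analyticRank = 0)
    (hadd : ∃ v : HeightOneSpectrum (𝓞 ℚ), ((2 : ℕ) : 𝓞 ℚ) ∉ v.asIdeal ∧ W.HasAdditiveReductionAt v)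
    (hgap : TowerGapAtTwo W) {n : ℕ}
    (hrank : ∀ (κ : ZpExtension ℚ 2) (γ : Field.absoluteGaloisGroup ℚ), κ.IsCyclotomic →
      κ.IsTopGenerator γ → IsCyclotomicVariable 2 γ → ∀ D : W.SelmerDualData κ γ,
      ∃ j : ℕ, 2 ^ n ≤ Nat.card (D.X ⧸ (towerIdeal 2 j • ⊤ : Submodule (IwasawaAlgebra 2) D.X)))
    (κ : ZpExtension ℚ 2) (γ : Field.absoluteGaloisGroup ℚ) (hκ : κ.IsCyclotomic)
    (hγ : κ.IsTopGenerator γ) (hγ' : IsCyclotomicVariable 2 γ) (D : W.SelmerDualData κ γ) :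
    n ≤ D.lambda := by
  haveI : Module.Finite (IwasawaAlgebra 2) D.X := D.module_finite_holds hγ
  obtain ⟨hX, hμ⟩ := isTorsion_and_mu_eq_zero_of_towerGapAtTwo W hgap hκ hγ hγ' D
  obtain ⟨j, hj⟩ := hrank κ γ hκ hγ hγ' D
  exact le_lambdaInvariant_of_pow_le_natCard_quotient_towerIdeal 2 hX hμ
    (fun N hN => SelmerCoinvEraseOne.forall_finite_eq_bot_two_of_additive_rankZero W hGZK hgo hr hadd κ γ hκ hγ D N hN) hj

/-! ## §2 The doors AT `W` — rational `2`-torsion allowed, analytic rank `0` (or `Sel` finite), NO `h415`, NO `hEC` -/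

/-- **Door: `MazurMainConjecture W 2`, rational `2`-torsion allowed, `Sel_{2^∞}(E/ℚ)` finite, NO `h415`.** PRINT {Kato 17.4 (1)(2)@2}
+ an additive `v ∤ 2` + DISPLAYED `hper₀` + `GoodOrd W 2` + certificates {`TowerGapAtTwo W`, RANK, `λ_an = n`, `μ_an = 0`}.
[cite: Kato2004Asterisque, Thm. 17.4 (1)(2) (p. 273)] [cite: GreenbergLNM1716, Prop. 4.15 (i) (pp. 124–125)] -/
theorem mazurMainConjecture_two_of_towerGap_of_towerRank_of_additive_finiteSelmer
    (h17 : ∀ [NeZero (W.conductorNorm ℤ)] (f : CuspForm (Gamma0 (W.conductorNorm ℤ)) 2),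
      kato_divisibility_allPrimes W 2 (f := f))
    [Finite (W.selmerGroupPInfty 2)]
    (hadd : ∃ v : HeightOneSpectrum (𝓞 ℚ), ((2 : ℕ) : 𝓞 ℚ) ∉ v.asIdeal ∧ W.HasAdditiveReductionAt v)
    (hper₀ : ∀ [NeZero (W.conductorNorm ℤ)] (f : CuspForm (Gamma0 (W.conductorNorm ℤ)) 2),
      IsNewformOf W f → ∀ ϖ : ℚ, (ϖ : ℝ) * W.realPeriodRat = plusPeriod f → 0 ≤ padicValRat 2 ϖ)
    (hgo : GoodOrd W 2) (hgap : TowerGapAtTwo W) {n : ℕ}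
    (hrank : ∀ (κ : ZpExtension ℚ 2) (γ : Field.absoluteGaloisGroup ℚ), κ.IsCyclotomic →
      κ.IsTopGenerator γ → IsCyclotomicVariable 2 γ → ∀ D : W.SelmerDualData κ γ,
      ∃ j : ℕ, 2 ^ n ≤ Nat.card (D.X ⧸ (towerIdeal 2 j • ⊤ : Submodule (IwasawaAlgebra 2) D.X)))
    (hlan : AnalyticLambdaEq W 2 n) (hμan : AnalyticMuLE W 2 0) : MazurMainConjecture W 2 :=
  mazurMainConjecture_two_of_towerGap_of_lambda_le W h17 hper₀ hgo hgap hlan hμan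
    (le_lambda_of_towerGap_of_towerRank_of_additive_finiteSelmer W hgo hadd hgap hrank)

/-- **Door: `MazurMainConjecture W 2` at analytic rank `0`, rational `2`-torsion allowed, NO `h415`.** PRINT {GZK, Kato 17.4 (1)(2)@2}
+ an additive `v ∤ 2` + DISPLAYED `hper₀` + `GoodOrd W 2`, `r_an = 0` + certificates {`TowerGapAtTwo W`, RANK, `λ_an = n`, `μ_an = 0`}.
[cite: Kato2004Asterisque, Thm. 17.4 (1)(2) (p. 273)] [cite: GreenbergLNM1716, Prop. 4.15 (i) (pp. 124–125)] [cite: Darmon2004, Thm. 3.22] -/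
theorem mazurMainConjecture_two_of_towerGap_of_towerRank_of_additive_rankZero
    (hGZK : rank_eq_analyticRank_of_analyticRank_le_one)
    (h17 : ∀ [NeZero (W.conductorNorm ℤ)] (f : CuspForm (Gamma0 (W.conductorNorm ℤ)) 2),
      kato_divisibility_allPrimes W 2 (f := f))
    (hadd : ∃ v : HeightOneSpectrum (𝓞 ℚ), ((2 : ℕ) : 𝓞 ℚ) ∉ v.asIdeal ∧ W.HasAdditiveReductionAt v)
    (hper₀ : ∀ [NeZero (W.conductorNorm ℤ)] (f : CuspForm (Gamma0 (W.conductorNorm ℤ)) 2),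
      IsNewformOf W f → ∀ ϖ : ℚ, (ϖ : ℝ) * W.realPeriodRat = plusPeriod f → 0 ≤ padicValRat 2 ϖ)
    (hgo : GoodOrd W 2) (hr : W.analyticRank = 0) (hgap : TowerGapAtTwo W) {n : ℕ}
    (hrank : ∀ (κ : ZpExtension ℚ 2) (γ : Field.absoluteGaloisGroup ℚ), κ.IsCyclotomic →
      κ.IsTopGenerator γ → IsCyclotomicVariable 2 γ → ∀ D : W.SelmerDualData κ γ,
      ∃ j : ℕ, 2 ^ n ≤ Nat.card (D.X ⧸ (towerIdeal 2 j • ⊤ : Submodule (IwasawaAlgebra 2) D.X)))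
    (hlan : AnalyticLambdaEq W 2 n) (hμan : AnalyticMuLE W 2 0) : MazurMainConjecture W 2 :=
  mazurMainConjecture_two_of_towerGap_of_lambda_le W h17 hper₀ hgo hgap hlan hμan
    (le_lambda_of_towerGap_of_towerRank_of_additive_rankZero W hGZK hgo hr hadd hgap hrank)

/-- **The Kato–Néron half AT `W` (item `OrdKatoHalfAtTwo`, 19271, at this curve), rational `2`-torsion allowed, `Sel` finite, NO
`h415`.** [cite: Kato2004Asterisque, Thm. 17.4 (1)(2) (p. 273)] [cite: GreenbergLNM1716, Prop. 4.15 (i) (pp. 124–125)] -/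
theorem katoHalfAt_two_of_towerGap_of_towerRank_of_additive_finiteSelmer
    (h17 : ∀ [NeZero (W.conductorNorm ℤ)] (f : CuspForm (Gamma0 (W.conductorNorm ℤ)) 2),
      kato_divisibility_allPrimes W 2 (f := f))
    [Finite (W.selmerGroupPInfty 2)]
    (hadd : ∃ v : HeightOneSpectrum (𝓞 ℚ), ((2 : ℕ) : 𝓞 ℚ) ∉ v.asIdeal ∧ W.HasAdditiveReductionAt v)
    (hper₀ : ∀ [NeZero (W.conductorNorm ℤ)] (f : CuspForm (Gamma0 (W.conductorNorm ℤ)) 2),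
      IsNewformOf W f → ∀ ϖ : ℚ, (ϖ : ℝ) * W.realPeriodRat = plusPeriod f → 0 ≤ padicValRat 2 ϖ)
    (hgo : GoodOrd W 2) (hgap : TowerGapAtTwo W) {n : ℕ}
    (hrank : ∀ (κ : ZpExtension ℚ 2) (γ : Field.absoluteGaloisGroup ℚ), κ.IsCyclotomic →
      κ.IsTopGenerator γ → IsCyclotomicVariable 2 γ → ∀ D : W.SelmerDualData κ γ,
      ∃ j : ℕ, 2 ^ n ≤ Nat.card (D.X ⧸ (towerIdeal 2 j • ⊤ : Submodule (IwasawaAlgebra 2) D.X)))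
    (hlan : AnalyticLambdaEq W 2 n) (hμan : AnalyticMuLE W 2 0) :
    MainConjectureLowerDivisibilityAtTwoOrd W :=
  katoHalfAt_two_of_towerGap_of_lambda_le W h17 hper₀ hgo hgap hlan hμan
    (le_lambda_of_towerGap_of_towerRank_of_additive_finiteSelmer W hgo hadd hgap hrank)

/-- **The Kato–Néron half AT `W` (item `OrdKatoHalfAtTwo`, 19271, at this curve) at analytic rank `0`, rational `2`-torsion allowed,
NO `h415`.** PRINT {GZK, Kato 17.4 (1)(2)@2} + an additive `v ∤ 2` + `hper₀` + `GoodOrd W 2`, `r_an = 0` + certificates.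
[cite: Kato2004Asterisque, Thm. 17.4 (1)(2) (p. 273)] [cite: GreenbergLNM1716, Prop. 4.15 (i) (pp. 124–125)] [cite: Darmon2004, Thm. 3.22] -/
theorem katoHalfAt_two_of_towerGap_of_towerRank_of_additive_rankZero
    (hGZK : rank_eq_analyticRank_of_analyticRank_le_one)
    (h17 : ∀ [NeZero (W.conductorNorm ℤ)] (f : CuspForm (Gamma0 (W.conductorNorm ℤ)) 2),
      kato_divisibility_allPrimes W 2 (f := f))
    (hadd : ∃ v : HeightOneSpectrum (𝓞 ℚ), ((2 : ℕ) : 𝓞 ℚ) ∉ v.asIdeal ∧ W.HasAdditiveReductionAt v)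
    (hper₀ : ∀ [NeZero (W.conductorNorm ℤ)] (f : CuspForm (Gamma0 (W.conductorNorm ℤ)) 2),
      IsNewformOf W f → ∀ ϖ : ℚ, (ϖ : ℝ) * W.realPeriodRat = plusPeriod f → 0 ≤ padicValRat 2 ϖ)
    (hgo : GoodOrd W 2) (hr : W.analyticRank = 0) (hgap : TowerGapAtTwo W) {n : ℕ}
    (hrank : ∀ (κ : ZpExtension ℚ 2) (γ : Field.absoluteGaloisGroup ℚ), κ.IsCyclotomic →
      κ.IsTopGenerator γ → IsCyclotomicVariable 2 γ → ∀ D : W.SelmerDualData κ γ,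
      ∃ j : ℕ, 2 ^ n ≤ Nat.card (D.X ⧸ (towerIdeal 2 j • ⊤ : Submodule (IwasawaAlgebra 2) D.X)))
    (hlan : AnalyticLambdaEq W 2 n) (hμan : AnalyticMuLE W 2 0) :
    MainConjectureLowerDivisibilityAtTwoOrd W :=
  katoHalfAt_two_of_towerGap_of_lambda_le W h17 hper₀ hgo hgap hlan hμan
    (le_lambda_of_towerGap_of_towerRank_of_additive_rankZero W hGZK hgo hr hadd hgap hrank)

/-- **The Eisenstein half AT `W` at analytic rank `0`, rational `2`-torsion allowed, NO `h415`** (through the full IMC).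
[cite: Kato2004Asterisque, Thm. 17.4 (1)(2) (p. 273)] [cite: GreenbergLNM1716, Prop. 4.15 (i) (pp. 124–125)] [cite: Darmon2004, Thm. 3.22] -/
theorem eisensteinAt_two_of_towerGap_of_towerRank_of_additive_rankZero
    (hGZK : rank_eq_analyticRank_of_analyticRank_le_one)
    (h17 : ∀ [NeZero (W.conductorNorm ℤ)] (f : CuspForm (Gamma0 (W.conductorNorm ℤ)) 2),
      kato_divisibility_allPrimes W 2 (f := f))
    (hadd : ∃ v : HeightOneSpectrum (𝓞 ℚ), ((2 : ℕ) : 𝓞 ℚ) ∉ v.asIdeal ∧ W.HasAdditiveReductionAt v)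
    (hper₀ : ∀ [NeZero (W.conductorNorm ℤ)] (f : CuspForm (Gamma0 (W.conductorNorm ℤ)) 2),
      IsNewformOf W f → ∀ ϖ : ℚ, (ϖ : ℝ) * W.realPeriodRat = plusPeriod f → 0 ≤ padicValRat 2 ϖ)
    (hgo : GoodOrd W 2) (hr : W.analyticRank = 0) (hgap : TowerGapAtTwo W) {n : ℕ}
    (hrank : ∀ (κ : ZpExtension ℚ 2) (γ : Field.absoluteGaloisGroup ℚ), κ.IsCyclotomic →
      κ.IsTopGenerator γ → IsCyclotomicVariable 2 γ → ∀ D : W.SelmerDualData κ γ,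
      ∃ j : ℕ, 2 ^ n ≤ Nat.card (D.X ⧸ (towerIdeal 2 j • ⊤ : Submodule (IwasawaAlgebra 2) D.X)))
    (hlan : AnalyticLambdaEq W 2 n) (hμan : AnalyticMuLE W 2 0) :
    MainConjectureEisensteinDivisibilityAtTwo W :=
  eisensteinAt_two_of_towerGap_of_lambda_le W h17 hper₀ hgo hgap hlan hμan
    (le_lambda_of_towerGap_of_towerRank_of_additive_rankZero W hGZK hgo hr hadd hgap hrank)

/-- **Door for `BSD(E,2)` at analytic rank `0`, rational `2`-torsion allowed, NO descent certificate, NO `hEC`, NO `h415`:**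
PRINT {modularity, GZK, Kato 17.4 (1)(2)@2} + an additive place `v ∤ 2` + DISPLAYED `hper₀` + `GoodOrd W 2`, `r_an = 0` +
certificates {`TowerGapAtTwo W`, RANK `hrank`, `λ_an = n`, `μ_an = 0`} ⇒ `BSDp W 2`. Greenberg's Thm. 4.1@2 is supplied by
`TorsionEulerChar.H46.twoAdicEulerCharRankZero` (GEN 39) and Prop. 4.15 (i) by `SelmerCoinvEraseOne.forall_finite_eq_bot_two_of_additive_rankZero`
(GEN 40). [cite: GreenbergLNM1716, Thm. 4.1 (p. 102), Prop. 4.15 (i) (pp. 124–125)] [cite: Kato2004Asterisque, Thm. 17.4 (1)(2) (p. 273)]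
[cite: Miller2011LMS, Def. 1.1] -/
theorem bsdp_two_of_towerGap_of_towerRank_of_additive_rankZero (hmod : nonempty_modularParametrizationData)
    (hGZK : rank_eq_analyticRank_of_analyticRank_le_one)
    (h17 : ∀ [NeZero (W.conductorNorm ℤ)] (f : CuspForm (Gamma0 (W.conductorNorm ℤ)) 2),
      kato_divisibility_allPrimes W 2 (f := f))
    (hadd : ∃ v : HeightOneSpectrum (𝓞 ℚ), ((2 : ℕ) : 𝓞 ℚ) ∉ v.asIdeal ∧ W.HasAdditiveReductionAt v)
    (hper₀ : ∀ [NeZero (W.conductorNorm ℤ)] (f : CuspForm (Gamma0 (W.conductorNorm ℤ)) 2),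
      IsNewformOf W f → ∀ ϖ : ℚ, (ϖ : ℝ) * W.realPeriodRat = plusPeriod f → 0 ≤ padicValRat 2 ϖ)
    (hgo : GoodOrd W 2) (hr : W.analyticRank = 0) (hgap : TowerGapAtTwo W) {n : ℕ}
    (hrank : ∀ (κ : ZpExtension ℚ 2) (γ : Field.absoluteGaloisGroup ℚ), κ.IsCyclotomic →
      κ.IsTopGenerator γ → IsCyclotomicVariable 2 γ → ∀ D : W.SelmerDualData κ γ,
      ∃ j : ℕ, 2 ^ n ≤ Nat.card (D.X ⧸ (towerIdeal 2 j • ⊤ : Submodule (IwasawaAlgebra 2) D.X)))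
    (hlan : AnalyticLambdaEq W 2 n) (hμan : AnalyticMuLE W 2 0) : BSDp W 2 :=
  bsdp_two_of_towerGap_of_lambda_le W hmod hGZK h17 (TorsionEulerChar.H46.twoAdicEulerCharRankZero W) hper₀ hgo hr hgap hlan
    hμan (le_lambda_of_towerGap_of_towerRank_of_additive_rankZero W hGZK hgo hr hadd hgap hrank)

/-- **Item `OrdMissingLowerBoundAtTwo` (19577) AT `W` at analytic rank `0`, rational `2`-torsion allowed, NO descent certificate, NO
`hEC`, NO `h415`**: the descent inequality `ord₂ #Ш_an ≤ ord₂ #Ш` at the curve through the Eisenstein half at `2`.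
[cite: GreenbergLNM1716, Thm. 4.1 (p. 102), Prop. 4.15 (i) (pp. 124–125)] [cite: Kato2004Asterisque, Thm. 17.4 (1)(2) (p. 273)] -/
theorem missingLowerBoundAt_two_of_towerGap_of_towerRank_of_additive_rankZero (hmod : nonempty_modularParametrizationData)
    (hGZK : rank_eq_analyticRank_of_analyticRank_le_one)
    (h17 : ∀ [NeZero (W.conductorNorm ℤ)] (f : CuspForm (Gamma0 (W.conductorNorm ℤ)) 2),
      kato_divisibility_allPrimes W 2 (f := f))
    (hadd : ∃ v : HeightOneSpectrum (𝓞 ℚ), ((2 : ℕ) : 𝓞 ℚ) ∉ v.asIdeal ∧ W.HasAdditiveReductionAt v)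
    (hper₀ : ∀ [NeZero (W.conductorNorm ℤ)] (f : CuspForm (Gamma0 (W.conductorNorm ℤ)) 2),
      IsNewformOf W f → ∀ ϖ : ℚ, (ϖ : ℝ) * W.realPeriodRat = plusPeriod f → 0 ≤ padicValRat 2 ϖ)
    (hgo : GoodOrd W 2) (hr : W.analyticRank = 0) (hgap : TowerGapAtTwo W) {n : ℕ}
    (hrank : ∀ (κ : ZpExtension ℚ 2) (γ : Field.absoluteGaloisGroup ℚ), κ.IsCyclotomic →
      κ.IsTopGenerator γ → IsCyclotomicVariable 2 γ → ∀ D : W.SelmerDualData κ γ,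
      ∃ j : ℕ, 2 ^ n ≤ Nat.card (D.X ⧸ (towerIdeal 2 j • ⊤ : Submodule (IwasawaAlgebra 2) D.X)))
    (hlan : AnalyticLambdaEq W 2 n) (hμan : AnalyticMuLE W 2 0) : MissingLowerBoundAt W 2 :=
  missingLowerBoundAt_two_of_eisenstein_of_kato W (TorsionEulerChar.H46.twoAdicEulerCharRankZero W) hmod hGZK h17 hr hgo
    (eisensteinAt_two_of_towerGap_of_towerRank_of_additive_rankZero W hGZK h17 hadd hper₀ hgo hr hgap hrank hlan hμan)

end Summit.BirchSwinnertonDyer.BirchSwinnertonDyer.Theorems.TowerLambdaTorsion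

end
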